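import Summits.Ventures.CertifiedManyBodySolver.Rows.DopedTLPairDominance
import Summits.Ventures.CertifiedManyBodySolver.Rows.DopedTLSpinStar
import Summits.Ventures.CertifiedManyBodySolver.Rows.DopedTLCorrOrigin
import Summits.Ventures.CertifiedManyBodySolver.Certificates.HubbardSquare_n7o8_corr_docc_rows257_261
import HarnessLib

/-!
# On-site (`s`-wave) pair correlations are capped by the double occupancy: two-sided DERIVED-CERTIFIED
# thermodynamic-limit pair cells at the M3′ point

HONEST FRAMING: first certified bounds; not a superconductivity verdict; every number certified or
labelled float.  Speedrun `mbsolver`, seat sr-mbsolver-m3-2 (pairing layer), gen 12, item (E).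
Theorem-only; no definition, no named fact; zero compute.

On-site pair `Δ_x = c_{x↑} c_{x↓} ∈ 𝔄_{{x}}`.  `Δ_x† Δ_x = n_{x↑} n_{x↓}` (`conjTranspose_pair_mul_pair`), so the
DIAGONAL on-site pair correlation IS the double occupancy (`corr_pair_self_eq`), and the Cauchy–Schwarz diagonal
dominance of `Rows/DopedTLPairDominance.lean` gives `|Re ω(Δ_x† Δ_y)| ≤ (𝒟(x) + 𝒟(y))/2` for EVERY state
(`abs_re_corr_pair_le_half_add`) and `|Re ω(Δ_x† Δ_y)| ≤ 𝒟 = Re ω(n_{0↑}n_{0↓})` for ALL `x, y` for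
translation-invariant states (`abs_re_corr_pair_le_docc`).  Kinematically `n_{x↑}n_{x↓} ≤ (n_{x↑} + n_{x↓})/2`
(`posSemidef_nAt_add_nAt_sub_docc_sub_docc`), so `𝒟 ≤ ρ/2` (`re_expect_doccAt0_le_half_density`).
Row grammar at the M3′ point (`U = 8`, `n = 7/8`), word `Γ(Δ_x)† Γ(Δ_y)` on `{x} ∪ {y}`:
* KINEMATIC (every `t′`, every window): `|Re ω(Δ_x† Δ_y)| ≤ 7/16` (`m3_onSitePair_upperRow_kinematic`, `…_lowerRow_…`);
* a docc UPPER row `M3DoccUpperRow t′ u dup` gives `±dup` for ALL `x, y` (`m3_onSitePair_upperRow_of_doccUpperRow`,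
  `…_lowerRow_…`); the diagonal lower row IS the docc lower row (`m3_onSitePair_self_lowerRow_of_doccLowerRow`);
* at the LANDED claim nodes of the CERTIFIED docc rows #261 (`t′ = 0`, window `u₁₆₆ = -47814009469263/2^46`) and
  #257 (`t′ = −1/4`, `u₁₄₉ = -2948854321395/2^42`): DERIVED-CERTIFIED two-sided cells
  `|Re ω(Δ_x† Δ_y)| ≤ 7649003484305130858433639/2^86 ≈ 0.0988611` (`t′ = 0`) / `≤ 456988009968292079185545/2^82
  ≈ 0.0945029` (`t′ = −1/4`) for ALL `x, y` (`m3_onSitePair_tp0_upper_of_r261`, `…_lower_…`, `m3_onSitePair_tpm1o4_…_r257`;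
  UNCONDITIONAL SHAPE with the e₀ uppers #166 / #149: `m3_onSitePair_tp0_uncond_of`, `m3_onSitePair_tpm1o4_uncond_of`),
  boxes `4.4×` / `4.6×` narrower than the kinematic `[−7/16, 7/16]`; diagonal lower edges `0.0142609` / `0.0079523`
  (`m3_onSitePair_self_tp0_lower_of_r261`, `m3_onSitePair_self_tpm1o4_lower_of_r257`).
HONEST LABEL: informative in the R-M3-22 sense (strictly inside the a-priori box) but physically unsurprising
(on-site pairing is suppressed at `U = 8`); no sign resolved; the on-site-pair off-diagonal long-range order density
is thereby certified `≤ 0.099 / 0.095` — weak, recorded as the first certified one.  Not a `d`-wave statement.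
References: Bratteli–Robinson I (2nd ed.) §2.3.3; Essler et al. (2005) §2.1–§2.2; Yang, Rev. Mod. Phys. 34 (1962) 694.
-/

noncomputable section

namespace Summit.Ventures.CertifiedManyBodySolver

open Matrix Literature.MathematicalPhysics.QuantumLattice Literature.Probability.LatticeModels
open Literature.MathematicalPhysics.QuantumLattice.HubbardWave0
open ThermodynamicLimit Filter Topology
open scoped BigOperators ComplexOrder

namespace OnSitePairTL

/-! ## Operator algebra -/

section Algebra

variable {d : ℕ} {Λ : Finset (Site d)} (x : Site d) (hx : x ∈ Λ)

/-- **`Δ_x† Δ_x = n_{x↑} n_{x↓}`** for the on-site pair `Δ_x = c_{x↑}c_{x↓}` in `𝔄_Λ`. Essler et al. (2005) §2.2.5 eq. (2.76); §2.1 eq. (2.8). [folklore] -/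
theorem conjTranspose_pair_mul_pair :
    (cAt x hx 0 * cAt x hx 1 : FermionOp Λ)ᴴ * (cAt x hx 0 * cAt x hx 1) = nAt x hx 0 * nAt x hx 1 := by
  have hne : orb (PolySite.pt x hx) (0 : Fin 2) ≠ orb (PolySite.pt x hx) 1 := fun h =>
    absurd (orb_eq_orb_iff.1 h).2 (by decide)
  show _ = creation (orb (PolySite.pt x hx) 0) * annihilation (orb (PolySite.pt x hx) 0) *
      (creation (orb (PolySite.pt x hx) 1) * annihilation (orb (PolySite.pt x hx) 1))
  rw [Matrix.conjTranspose_mul, annihilation_conjTranspose, annihilation_conjTranspose]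
  calc creation (orb (PolySite.pt x hx) 1) * creation (orb (PolySite.pt x hx) 0) *
        (annihilation (orb (PolySite.pt x hx) 0) * annihilation (orb (PolySite.pt x hx) 1))
      = creation (orb (PolySite.pt x hx) 1) * (creation (orb (PolySite.pt x hx) 0) *
          annihilation (orb (PolySite.pt x hx) 0)) * annihilation (orb (PolySite.pt x hx) 1) := by
        noncomm_ring
    _ = creation (orb (PolySite.pt x hx) 0) * annihilation (orb (PolySite.pt x hx) 0) *
          creation (orb (PolySite.pt x hx) 1) * annihilation (orb (PolySite.pt x hx) 1) := by
        rw [← number_mul_creation_of_ne hne]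
    _ = _ := by rw [Matrix.mul_assoc]

/-- **`n_{x↑} n_{x↓} ≤ (n_{x↑} + n_{x↓})/2`** as an operator inequality: `n_{x↑} + n_{x↓} − 2 n_{x↑}n_{x↓} ⪰ 0` (diagonal in the occupation basis with entries in `{0, 1}`). [cite: EsslerEtAl2005, §2.2.5 eq. (2.76)] -/
theorem posSemidef_nAt_add_nAt_sub_docc_sub_docc :
    ((nAt x hx 0 : FermionOp Λ) + nAt x hx 1 - nAt x hx 0 * nAt x hx 1 -
      nAt x hx 0 * nAt x hx 1).PosSemidef := by
  rw [nAt, nAt, LiebThm1.numberOp_eq_diagonal, LiebThm1.numberOp_eq_diagonal, diagonal_mul_diagonal,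
    diagonal_add, diagonal_sub, diagonal_sub, posSemidef_diagonal_iff]
  intro s
  split_ifs <;> norm_num

end Algebra

/-! ## States -/

section State

variable {d : ℕ} (ω : InfVolFermionState d)

/-- **The diagonal on-site pair correlation is the double occupancy**: `ω(Δ_x† Δ_x) = ω(n_{x↑} n_{x↓})` (isotony). [cite: ArakiMoriya2003, §4.1 Def. 4.1 (2)] -/
theorem corr_pair_self_eq (x : Site d) :
    ω.corr (cAt x (Finset.mem_singleton_self x) 0 * cAt x (Finset.mem_singleton_self x) 1 :
        FermionOp ({x} : Finset (Site d)))ᴴ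
      (cAt x (Finset.mem_singleton_self x) 0 * cAt x (Finset.mem_singleton_self x) 1) =
    ω.expect {x} (nAt x (Finset.mem_singleton_self x) 0 * nAt x (Finset.mem_singleton_self x) 1) := by
  rw [InfVolFermionState.corr_eq, ← map_mul, conjTranspose_pair_mul_pair, ω.compatible]

/-- **Every state: `|Re ω(Δ_x† Δ_y)| ≤ (𝒟(x) + 𝒟(y))/2`** (Cauchy–Schwarz / diagonal dominance). [cite: BratteliRobinsonI1987, §2.3.3 (Thm. 2.3.16)] -/
theorem abs_re_corr_pair_le_half_add (x y : Site d) :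
    |(ω.expect ({x} ∪ {y})
        (fermionEmbed (PolySite.incl Finset.subset_union_left)
            (cAt x (Finset.mem_singleton_self x) 0 * cAt x (Finset.mem_singleton_self x) 1 :
              FermionOp ({x} : Finset (Site d)))ᴴ *
          fermionEmbed (PolySite.incl Finset.subset_union_right)
            (cAt y (Finset.mem_singleton_self y) 0 * cAt y (Finset.mem_singleton_self y) 1 :
              FermionOp ({y} : Finset (Site d))))).re| ≤
      ((ω.expect {x} (nAt x (Finset.mem_singleton_self x) 0 * nAt x (Finset.mem_singleton_self x) 1)).re +
        (ω.expect {y} (nAt y (Finset.mem_singleton_self y) 0 * nAt y (Finset.mem_singleton_self y) 1)).re) / 2 := by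
  have h := Observables.SingletPair.abs_re_corr_le_half_add ω
    (cAt x (Finset.mem_singleton_self x) 0 * cAt x (Finset.mem_singleton_self x) 1 :
      FermionOp ({x} : Finset (Site d)))
    (cAt y (Finset.mem_singleton_self y) 0 * cAt y (Finset.mem_singleton_self y) 1 :
      FermionOp ({y} : Finset (Site d)))
  rwa [corr_pair_self_eq, corr_pair_self_eq, InfVolFermionState.corr_eq] at h

variable {ω}

/-- **Translation-invariant states: `|Re ω(Δ_x† Δ_y)| ≤ 𝒟 = Re ω(n_{0↑}n_{0↓})` for ALL `x, y`.** [cite: BratteliRobinsonI1987, §2.3.3 (Thm. 2.3.16)] -/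
theorem abs_re_corr_pair_le_docc (hω : ω.IsTranslationInvariant) (x y : Site d) :
    |(ω.expect ({x} ∪ {y})
        (fermionEmbed (PolySite.incl Finset.subset_union_left)
            (cAt x (Finset.mem_singleton_self x) 0 * cAt x (Finset.mem_singleton_self x) 1 :
              FermionOp ({x} : Finset (Site d)))ᴴ *
          fermionEmbed (PolySite.incl Finset.subset_union_right)
            (cAt y (Finset.mem_singleton_self y) 0 * cAt y (Finset.mem_singleton_self y) 1 :
              FermionOp ({y} : Finset (Site d))))).re| ≤ (ω.expect {0} (doccAt0 d)).re := by
  have h := abs_re_corr_pair_le_half_add ω x y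
  rw [SpinStarTL.expect_nAt_mul_nAt_eq hω x, SpinStarTL.expect_nAt_mul_nAt_eq hω y] at h
  linarith

/-- Translation-invariant states: the diagonal word reads the double occupancy, `Re ω(Γ(Δ_x)† Γ(Δ_x)) = Re ω(n_{0↑}n_{0↓})`. [cite: ArakiMoriya2003, §4.1 Def. 4.5] -/
theorem re_expect_pair_self_eq_docc (hω : ω.IsTranslationInvariant) (x : Site d) :
    (ω.expect ({x} ∪ {x})
        (fermionEmbed (PolySite.incl Finset.subset_union_left)
            (cAt x (Finset.mem_singleton_self x) 0 * cAt x (Finset.mem_singleton_self x) 1 :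
              FermionOp ({x} : Finset (Site d)))ᴴ *
          fermionEmbed (PolySite.incl Finset.subset_union_right)
            (cAt x (Finset.mem_singleton_self x) 0 * cAt x (Finset.mem_singleton_self x) 1 :
              FermionOp ({x} : Finset (Site d))))).re = (ω.expect {0} (doccAt0 d)).re := by
  rw [← SpinStarTL.expect_nAt_mul_nAt_eq hω x, ← corr_pair_self_eq, InfVolFermionState.corr_eq]

/-- **KINEMATIC: `𝒟 ≤ ρ/2`** for translation-invariant states (`n_{x↑}n_{x↓} ≤ (n_{x↑}+n_{x↓})/2`). [cite: EsslerEtAl2005, §2.2.5 eq. (2.76)] -/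
theorem re_expect_doccAt0_le_half_density (hω : ω.IsTranslationInvariant) :
    (ω.expect {0} (doccAt0 d)).re ≤ ω.density / 2 := by
  have h : 0 ≤ (ω.expect {0} (nAt 0 (Finset.mem_singleton_self 0) 0 + nAt 0 (Finset.mem_singleton_self 0) 1 -
      doccAt0 d - doccAt0 d)).re :=
    ω.expect_re_nonneg_of_posSemidef {0} (posSemidef_nAt_add_nAt_sub_docc_sub_docc 0 _)
  rw [map_sub, map_sub, Complex.sub_re, Complex.sub_re,
    SpinStarTL.re_expect_nAt_add_nAt_eq_density hω 0] at h
  linarith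

end State

end OnSitePairTL

/-! ## Row grammar at the M3′ point (`U = 8`, `n = 7/8`): on-site pair cells -/

section M3

open OnSitePairTL

variable {tp : ℝ} {u dup dlo : ℚ}

/-- **M3′: a docc UPPER row caps every on-site pair row**: `M3DoccUpperRow t′ u dup → M3CorrUpperRow t′ u dup ({x} ∪ {y}) (Γ(Δ_x)† Γ(Δ_y))` for all `x, y` (row states are translation invariant). DERIVED cell. [cite: BratteliRobinsonI1987, §2.3.3 (Thm. 2.3.16)] -/
theorem m3_onSitePair_upperRow_of_doccUpperRow (hd : M3DoccUpperRow tp u dup) (x y : Site 2) :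
    M3CorrUpperRow tp u dup ({x} ∪ {y})
      (fermionEmbed (PolySite.incl Finset.subset_union_left)
          (cAt x (Finset.mem_singleton_self x) 0 * cAt x (Finset.mem_singleton_self x) 1 :
            FermionOp ({x} : Finset (Site 2)))ᴴ *
        fermionEmbed (PolySite.incl Finset.subset_union_right)
          (cAt y (Finset.mem_singleton_self y) 0 * cAt y (Finset.mem_singleton_self y) 1 :
            FermionOp ({y} : Finset (Site 2)))) := by
  intro ω Ls ψ hLs hψ hψ1 hω hu
  obtain ⟨hTI, -⟩ := SpinStarTL.m3_rowState_invariances hLs hψ hψ1 hω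
  have hD := hd ω Ls ψ hLs hψ hψ1 hω hu
  have h := abs_re_corr_pair_le_docc hTI x y
  linarith [(abs_le.1 h).2]

/-- **… and floors it by `−dup`**: `M3DoccUpperRow t′ u dup → M3CorrLowerRow t′ u (−dup) ({x} ∪ {y}) (Γ(Δ_x)† Γ(Δ_y))`. DERIVED cell. [cite: BratteliRobinsonI1987, §2.3.3 (Thm. 2.3.16)] -/
theorem m3_onSitePair_lowerRow_of_doccUpperRow (hd : M3DoccUpperRow tp u dup) (x y : Site 2) :
    M3CorrLowerRow tp u (-dup) ({x} ∪ {y})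
      (fermionEmbed (PolySite.incl Finset.subset_union_left)
          (cAt x (Finset.mem_singleton_self x) 0 * cAt x (Finset.mem_singleton_self x) 1 :
            FermionOp ({x} : Finset (Site 2)))ᴴ *
        fermionEmbed (PolySite.incl Finset.subset_union_right)
          (cAt y (Finset.mem_singleton_self y) 0 * cAt y (Finset.mem_singleton_self y) 1 :
            FermionOp ({y} : Finset (Site 2)))) := by
  intro ω Ls ψ hLs hψ hψ1 hω hu
  obtain ⟨hTI, -⟩ := SpinStarTL.m3_rowState_invariances hLs hψ hψ1 hω
  have hD := hd ω Ls ψ hLs hψ hψ1 hω hu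
  have h := abs_re_corr_pair_le_docc hTI x y
  push_cast
  linarith [(abs_le.1 h).1]

/-- **KINEMATIC at density `7/8` (no certificate, every `t′`, every window)**: `Re ω(Δ_x† Δ_y) ≤ 7/16` (`|Re ω(Δ_x† Δ_y)| ≤ 𝒟 ≤ ρ/2`). [cite: BratteliRobinsonI1987, §2.3.3 (Thm. 2.3.16)] -/
theorem m3_onSitePair_upperRow_kinematic (tp : ℝ) (u : ℚ) (x y : Site 2) :
    M3CorrUpperRow tp u (7 / 16) ({x} ∪ {y})
      (fermionEmbed (PolySite.incl Finset.subset_union_left)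
          (cAt x (Finset.mem_singleton_self x) 0 * cAt x (Finset.mem_singleton_self x) 1 :
            FermionOp ({x} : Finset (Site 2)))ᴴ *
        fermionEmbed (PolySite.incl Finset.subset_union_right)
          (cAt y (Finset.mem_singleton_self y) 0 * cAt y (Finset.mem_singleton_self y) 1 :
            FermionOp ({y} : Finset (Site 2)))) := by
  intro ω Ls ψ hLs hψ hψ1 hω _
  obtain ⟨hTI, hn⟩ := SpinStarTL.m3_rowState_invariances hLs hψ hψ1 hω
  have hD := re_expect_doccAt0_le_half_density hTI
  have h := abs_re_corr_pair_le_docc hTI x y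
  rw [hn] at hD
  push_cast
  linarith [(abs_le.1 h).2]

/-- KINEMATIC at density `7/8`: `−7/16 ≤ Re ω(Δ_x† Δ_y)`. [cite: BratteliRobinsonI1987, §2.3.3 (Thm. 2.3.16)] -/
theorem m3_onSitePair_lowerRow_kinematic (tp : ℝ) (u : ℚ) (x y : Site 2) :
    M3CorrLowerRow tp u (-(7 / 16)) ({x} ∪ {y})
      (fermionEmbed (PolySite.incl Finset.subset_union_left)
          (cAt x (Finset.mem_singleton_self x) 0 * cAt x (Finset.mem_singleton_self x) 1 :
            FermionOp ({x} : Finset (Site 2)))ᴴ *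
        fermionEmbed (PolySite.incl Finset.subset_union_right)
          (cAt y (Finset.mem_singleton_self y) 0 * cAt y (Finset.mem_singleton_self y) 1 :
            FermionOp ({y} : Finset (Site 2)))) := by
  intro ω Ls ψ hLs hψ hψ1 hω _
  obtain ⟨hTI, hn⟩ := SpinStarTL.m3_rowState_invariances hLs hψ hψ1 hω
  have hD := re_expect_doccAt0_le_half_density hTI
  have h := abs_re_corr_pair_le_docc hTI x y
  rw [hn] at hD
  push_cast
  linarith [(abs_le.1 h).1]

/-- **Diagonal rows ARE docc rows**: `M3DoccLowerRow t′ u dlo → M3CorrLowerRow t′ u dlo ({x} ∪ {x}) (Γ(Δ_x)† Γ(Δ_x))` (the upper companion is the case `x = y` of `m3_onSitePair_upperRow_of_doccUpperRow`). [cite: ArakiMoriya2003, §4.1 Def. 4.5] -/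
theorem m3_onSitePair_self_lowerRow_of_doccLowerRow (hd : M3DoccLowerRow tp u dlo) (x : Site 2) :
    M3CorrLowerRow tp u dlo ({x} ∪ {x})
      (fermionEmbed (PolySite.incl Finset.subset_union_left)
          (cAt x (Finset.mem_singleton_self x) 0 * cAt x (Finset.mem_singleton_self x) 1 :
            FermionOp ({x} : Finset (Site 2)))ᴴ *
        fermionEmbed (PolySite.incl Finset.subset_union_right)
          (cAt x (Finset.mem_singleton_self x) 0 * cAt x (Finset.mem_singleton_self x) 1 :
            FermionOp ({x} : Finset (Site 2)))) := by
  intro ω Ls ψ hLs hψ hψ1 hω hu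
  obtain ⟨hTI, -⟩ := SpinStarTL.m3_rowState_invariances hLs hψ hψ1 hω
  rw [re_expect_pair_self_eq_docc hTI x]
  exact hd ω Ls ψ hLs hψ hψ1 hω hu

end M3

/-! ### At the landed claim nodes of the CERTIFIED docc rows #261 (`t′ = 0`) and #257 (`t′ = −1/4`) -/

section Certified

open Summit.Ventures.CertifiedManyBodySolver.Certificates

/-- **DERIVED-CERTIFIED, `t′ = 0`** (claim node #261 Dup, window `u₁₆₆ = -47814009469263/2^46`): `Re ω(Δ_x† Δ_y) ≤ 7649003484305130858433639/2^86 ≈ 0.0988611`, all `x, y`. [cite: BratteliRobinsonI1987, §2.3.3 (Thm. 2.3.16)] -/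
theorem m3_onSitePair_tp0_upper_of_r261 (hd : cert_r261_lro_M3U8tp0_w2_b4_kry1_kry2c3_hop2_Dup)
    (x y : Site 2) :
    M3CorrUpperRow 0 (-47814009469263 / 70368744177664)
      (7649003484305130858433639 / 77371252455336267181195264) ({x} ∪ {y})
      (fermionEmbed (PolySite.incl Finset.subset_union_left)
          (cAt x (Finset.mem_singleton_self x) 0 * cAt x (Finset.mem_singleton_self x) 1 :
            FermionOp ({x} : Finset (Site 2)))ᴴ *
        fermionEmbed (PolySite.incl Finset.subset_union_right)
          (cAt y (Finset.mem_singleton_self y) 0 * cAt y (Finset.mem_singleton_self y) 1 :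
            FermionOp ({y} : Finset (Site 2)))) := by
  have h := m3_onSitePair_upperRow_of_doccUpperRow
    (M3CorrOrbitLowerRow.doccUpperRow hd Finset.univ_nonempty) x y
  convert h using 2
  all_goals norm_num

/-- **DERIVED-CERTIFIED, `t′ = 0`**: `−7649003484305130858433639/2^86 ≤ Re ω(Δ_x† Δ_y)` for ALL `x, y`. [cite: BratteliRobinsonI1987, §2.3.3 (Thm. 2.3.16)] -/
theorem m3_onSitePair_tp0_lower_of_r261 (hd : cert_r261_lro_M3U8tp0_w2_b4_kry1_kry2c3_hop2_Dup)
    (x y : Site 2) :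
    M3CorrLowerRow 0 (-47814009469263 / 70368744177664)
      (-(7649003484305130858433639 / 77371252455336267181195264)) ({x} ∪ {y})
      (fermionEmbed (PolySite.incl Finset.subset_union_left)
          (cAt x (Finset.mem_singleton_self x) 0 * cAt x (Finset.mem_singleton_self x) 1 :
            FermionOp ({x} : Finset (Site 2)))ᴴ *
        fermionEmbed (PolySite.incl Finset.subset_union_right)
          (cAt y (Finset.mem_singleton_self y) 0 * cAt y (Finset.mem_singleton_self y) 1 :
            FermionOp ({y} : Finset (Site 2)))) := by
  have h := m3_onSitePair_lowerRow_of_doccUpperRow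
    (M3CorrOrbitLowerRow.doccUpperRow hd Finset.univ_nonempty) x y
  convert h using 2
  all_goals norm_num

/-- **DERIVED-CERTIFIED, `t′ = 0`, diagonal** (claim node #261 Dlo): `275845906240274393889863/2^84 ≈ 0.0142609 ≤ Re ω(Δ_x† Δ_x)` for every `x`. [cite: ArakiMoriya2003, §4.1 Def. 4.5] -/
theorem m3_onSitePair_self_tp0_lower_of_r261 (hd : cert_r261_lro_M3U8tp0_w2_b4_kry1_kry2c3_hop2_Dlo)
    (x : Site 2) :
    M3CorrLowerRow 0 (-47814009469263 / 70368744177664)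
      (275845906240274393889863 / 19342813113834066795298816) ({x} ∪ {x})
      (fermionEmbed (PolySite.incl Finset.subset_union_left)
          (cAt x (Finset.mem_singleton_self x) 0 * cAt x (Finset.mem_singleton_self x) 1 :
            FermionOp ({x} : Finset (Site 2)))ᴴ *
        fermionEmbed (PolySite.incl Finset.subset_union_right)
          (cAt x (Finset.mem_singleton_self x) 0 * cAt x (Finset.mem_singleton_self x) 1 :
            FermionOp ({x} : Finset (Site 2)))) :=
  m3_onSitePair_self_lowerRow_of_doccLowerRow (M3CorrOrbitLowerRow.doccLowerRow hd Finset.univ_nonempty) x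

/-- **DERIVED-CERTIFIED, `t′ = −1/4`** (claim node #257 Dup, window `u₁₄₉ = -2948854321395/2^42`): `Re ω(Δ_x† Δ_y) ≤ 456988009968292079185545/2^82 ≈ 0.0945029` for ALL `x, y`. [cite: BratteliRobinsonI1987, §2.3.3 (Thm. 2.3.16)] -/
theorem m3_onSitePair_tpm1o4_upper_of_r257 (hd : cert_r257_lro_M3U8tpm1o4_w2_b4_kry1_kry2c3_hop2_Dup)
    (x y : Site 2) :
    M3CorrUpperRow (-1 / 4) (-2948854321395 / 4398046511104)
      (456988009968292079185545 / 4835703278458516698824704) ({x} ∪ {y})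
      (fermionEmbed (PolySite.incl Finset.subset_union_left)
          (cAt x (Finset.mem_singleton_self x) 0 * cAt x (Finset.mem_singleton_self x) 1 :
            FermionOp ({x} : Finset (Site 2)))ᴴ *
        fermionEmbed (PolySite.incl Finset.subset_union_right)
          (cAt y (Finset.mem_singleton_self y) 0 * cAt y (Finset.mem_singleton_self y) 1 :
            FermionOp ({y} : Finset (Site 2)))) := by
  have h := m3_onSitePair_upperRow_of_doccUpperRow
    (M3CorrOrbitLowerRow.doccUpperRow hd Finset.univ_nonempty) x y
  convert h using 2
  all_goals norm_num

/-- **DERIVED-CERTIFIED, `t′ = −1/4`**: `−456988009968292079185545/2^82 ≤ Re ω(Δ_x† Δ_y)` for ALL `x, y`. [cite: BratteliRobinsonI1987, §2.3.3 (Thm. 2.3.16)] -/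
theorem m3_onSitePair_tpm1o4_lower_of_r257 (hd : cert_r257_lro_M3U8tpm1o4_w2_b4_kry1_kry2c3_hop2_Dup)
    (x y : Site 2) :
    M3CorrLowerRow (-1 / 4) (-2948854321395 / 4398046511104)
      (-(456988009968292079185545 / 4835703278458516698824704)) ({x} ∪ {y})
      (fermionEmbed (PolySite.incl Finset.subset_union_left)
          (cAt x (Finset.mem_singleton_self x) 0 * cAt x (Finset.mem_singleton_self x) 1 :
            FermionOp ({x} : Finset (Site 2)))ᴴ *
        fermionEmbed (PolySite.incl Finset.subset_union_right)
          (cAt y (Finset.mem_singleton_self y) 0 * cAt y (Finset.mem_singleton_self y) 1 :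
            FermionOp ({y} : Finset (Site 2)))) := by
  have h := m3_onSitePair_lowerRow_of_doccUpperRow
    (M3CorrOrbitLowerRow.doccUpperRow hd Finset.univ_nonempty) x y
  convert h using 2
  all_goals norm_num

/-- **DERIVED-CERTIFIED, `t′ = −1/4`, diagonal** (claim node #257 Dlo): `38455087907569911627595/2^82 ≈ 0.0079523 ≤ Re ω(Δ_x† Δ_x)` for every `x`. [cite: ArakiMoriya2003, §4.1 Def. 4.5] -/
theorem m3_onSitePair_self_tpm1o4_lower_of_r257 (hd : cert_r257_lro_M3U8tpm1o4_w2_b4_kry1_kry2c3_hop2_Dlo)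
    (x : Site 2) :
    M3CorrLowerRow (-1 / 4) (-2948854321395 / 4398046511104)
      (38455087907569911627595 / 4835703278458516698824704) ({x} ∪ {x})
      (fermionEmbed (PolySite.incl Finset.subset_union_left)
          (cAt x (Finset.mem_singleton_self x) 0 * cAt x (Finset.mem_singleton_self x) 1 :
            FermionOp ({x} : Finset (Site 2)))ᴴ *
        fermionEmbed (PolySite.incl Finset.subset_union_right)
          (cAt x (Finset.mem_singleton_self x) 0 * cAt x (Finset.mem_singleton_self x) 1 :
            FermionOp ({x} : Finset (Site 2)))) :=
  m3_onSitePair_self_lowerRow_of_doccLowerRow (M3CorrOrbitLowerRow.doccLowerRow hd Finset.univ_nonempty) x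

/-- **`t′ = 0`, UNCONDITIONAL SHAPE, ALL HYPOTHESES LANDED CLAIM NODES** (docc upper #261, e₀ upper #166 = the window literal): `|Re ω(Δ_x† Δ_y)| ≤ 7649003484305130858433639/2^86 ≈ 0.0988611` for ALL `x, y` and EVERY torus limit of unit `(rectN (7/8) L, S^z = 0)`-sector ground states of `hubbardTorusTT' L 1 0 8` — no energy hypothesis in the conclusion. [cite: WangEtAl2024, §III] -/
theorem m3_onSitePair_tp0_uncond_of (hd : cert_r261_lro_M3U8tp0_w2_b4_kry1_kry2c3_hop2_Dup)
    (hE : cert_r166_openbox_32x4_U8_N112_tp0_D1000_b2) (x y : Site 2) :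
    ∀ (ω : InfVolFermionState 2) (Ls : ℕ → ℕ) (ψ : ∀ L, Fock (Orb (FermionTorus 2 L))),
      Tendsto Ls atTop atTop →
      (∀ j, IsGroundStateInSector (hubbardTorusTT' (Ls j) 1 0 8) (rectN (7 / 8) (Ls j)) 0 (ψ (Ls j))) →
      (∀ j, star (ψ (Ls j)) ⬝ᵥ ψ (Ls j) = 1) → ω.IsTorusLimitOf ψ Ls →
      |(ω.expect ({x} ∪ {y})
          (fermionEmbed (PolySite.incl Finset.subset_union_left)
              (cAt x (Finset.mem_singleton_self x) 0 * cAt x (Finset.mem_singleton_self x) 1 :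
                FermionOp ({x} : Finset (Site 2)))ᴴ *
            fermionEmbed (PolySite.incl Finset.subset_union_right)
              (cAt y (Finset.mem_singleton_self y) 0 * cAt y (Finset.mem_singleton_self y) 1 :
                FermionOp ({y} : Finset (Site 2))))).re| ≤
        7649003484305130858433639 / 77371252455336267181195264 := by
  intro ω Ls ψ h1 h2 h3 h4
  have hu : energyDensityTT' 1 0 8 (7 / 8) ≤ (((-47814009469263 / 70368744177664 : ℚ)) : ℝ) :=
    m3_tp0_upper_r166_of hE
  have hup := m3_onSitePair_tp0_upper_of_r261 hd x y ω Ls ψ h1 h2 h3 h4 hu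
  have hlo := m3_onSitePair_tp0_lower_of_r261 hd x y ω Ls ψ h1 h2 h3 h4 hu
  push_cast at hup hlo
  exact abs_le.2 ⟨by linarith, by linarith⟩

/-- **`t′ = −1/4`, UNCONDITIONAL SHAPE, ALL HYPOTHESES LANDED CLAIM NODES** (docc upper #257, e₀ upper #149 = the window literal): `|Re ω(Δ_x† Δ_y)| ≤ 456988009968292079185545/2^82 ≈ 0.0945029` for ALL `x, y` and EVERY torus limit of unit `(rectN (7/8) L, S^z = 0)`-sector ground states of `hubbardTorusTT' L 1 (−1/4) 8`. [cite: WangEtAl2024, §III] -/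
theorem m3_onSitePair_tpm1o4_uncond_of (hd : cert_r257_lro_M3U8tpm1o4_w2_b4_kry1_kry2c3_hop2_Dup)
    (hE : cert_r149_openbox_16x4_U8_N56_tpm1o4_D1600) (x y : Site 2) :
    ∀ (ω : InfVolFermionState 2) (Ls : ℕ → ℕ) (ψ : ∀ L, Fock (Orb (FermionTorus 2 L))),
      Tendsto Ls atTop atTop →
      (∀ j, IsGroundStateInSector (hubbardTorusTT' (Ls j) 1 (-1 / 4) 8) (rectN (7 / 8) (Ls j)) 0 (ψ (Ls j))) →
      (∀ j, star (ψ (Ls j)) ⬝ᵥ ψ (Ls j) = 1) → ω.IsTorusLimitOf ψ Ls →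
      |(ω.expect ({x} ∪ {y})
          (fermionEmbed (PolySite.incl Finset.subset_union_left)
              (cAt x (Finset.mem_singleton_self x) 0 * cAt x (Finset.mem_singleton_self x) 1 :
                FermionOp ({x} : Finset (Site 2)))ᴴ *
            fermionEmbed (PolySite.incl Finset.subset_union_right)
              (cAt y (Finset.mem_singleton_self y) 0 * cAt y (Finset.mem_singleton_self y) 1 :
                FermionOp ({y} : Finset (Site 2))))).re| ≤
        456988009968292079185545 / 4835703278458516698824704 := by
  intro ω Ls ψ h1 h2 h3 h4
  have hu : energyDensityTT' 1 (-1 / 4) 8 (7 / 8) ≤ (((-2948854321395 / 4398046511104 : ℚ)) : ℝ) :=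
    m3_tpm1o4_upper_r149_of hE
  have hup := m3_onSitePair_tpm1o4_upper_of_r257 hd x y ω Ls ψ h1 h2 h3 h4 hu
  have hlo := m3_onSitePair_tpm1o4_lower_of_r257 hd x y ω Ls ψ h1 h2 h3 h4 hu
  push_cast at hup hlo
  exact abs_le.2 ⟨by linarith, by linarith⟩

end Certified

end Summit.Ventures.CertifiedManyBodySolver

end
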